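import Summits.BirchSwinnertonDyer.BirchSwinnertonDyer.Theorems.ShaPrimaryTransferFiniteShaComponentTransferOddDoor
import Literature.NumberTheory.EllipticCurves.TwoIsogenyShaTwoTorsionBound
import Literature.NumberTheory.EllipticCurves.Curve346SelmerBoundXIsogenous
import Literature.NumberTheory.EllipticCurves.TwoIsogenyShaTwoTorsionExamples
import HarnessLib

/-!
# BirchSwinnertonDyer / ShaPrimaryTransfer — crux `FiniteShaComponentTransfer` (stmt-BirchSwinnertonDyer-22356):
# THE ODD DOOR USED — `#Ш(X/ℚ)[2] = 4` EXACTLY for the rank-`2` curve `X = [0, −346, 0, 1369, 0]`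
# (descent brackets `4 ≤ #Ш(X)[2] ≤ 8`; Cassels–Tate parity `#Ш(X)[2] = 4^m` decides)

Third helper file of prover seat `bsd-line-spt-p1` g13 (`--supports stmt-22356 --as helper`; same namespace as
`…OddDoor`, `…OddDoorDefect`). THEOREMS ONLY; no definition, no named fact, no `sorry`. BSD is NOT proved by
any of this; T is unchanged (conjecture-grade at analytic rank ≥ 2).

The rank-`2` ISOGENY-DOOR curve of this route (seat g11, `Curve346*`): `X : y² = x³ − 346x² + 1369x`,
`X' = X/⟨(0,0)⟩ = [0, 692, 0, 114240, 0]`, `rank X(ℚ) = 2`, `t_2(X) = 0` (through the isogenous sharp curve `Y`),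
and `#Ш(X/ℚ)[φ] = #(Ш(X) ∩ im Ξ_X) = 4` — a non-trivial `Ш[2]` whose exact order the descent did NOT give. Now:

* §1 THE BRACKET (pure descent): `4 = #Ш(X)[φ] ≤ #Ш(X/ℚ)[2] ≤ #Ш(X)[φ] · #Ш(X')[φ̂] ≤ 4 · 2 = 8`
  (`natCard_sha_torsionBy_two_X_mem`; the exact sequence `0 → Ш(X)[φ] → Ш(X)[2] → Ш(X')[φ̂]` of
  `TwoIsogenyShaTwoTorsionBound`, and `#Ш(X')[φ̂] ≤ 2` from `S(−1384, 21904) ⊆ {1, 37}`,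
  `Curve346SelmerBoundXIsogenous` — the class `37` is left undecided).
* §2 THE PARITY DECIDES: `t_2(X) = 0` and Cassels–Tate (`…OddDoor` §1: `#Ш(X)[2] = 2^{t_2 + 2m} = 4^m`) leave
  `#Ш(X/ℚ)[2] ∈ {1, 4, 16, …}`; with the bracket, **`#Ш(X/ℚ)[2] = 4`** (`natCard_sha_torsionBy_two_X`) — a SECOND,
  INDEPENDENT route to a value the tree ALREADY HAD (seat g11, 2026-08-28: `ShaTwoTorsionExamples.natCard_sha_inf_torsionBy_two_X346`,
  via the sharp dual bound `S(−1384, 21904) ⊆ {1}` of `subset_S_X346dual` and `TwoIsogenyShaTwoTorsionEqPhi`; CORRECTION of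
  this file's first version and of `Curve346SelmerBoundXIsogenous`, which duplicate that Selmer bound: the parity route is what
  is new — it decides `#Ш[2]` with the class `37` left UNDECIDED) — and **`Ш(X/ℚ)[2] = Ш(X/ℚ)[φ]`** as subgroups of `H¹(ℚ, X)`
  (`sha_inf_torsionBy_two_X_eq`), `Ш(X/ℚ)[2] ≅ (ℤ/2ℤ)²` (`nonempty_sha_torsionBy_two_X_equiv`), `m = 1` in §1 of
  `…OddDoor` (`natCard_sha_torsionBy_two_X_eq_pow`: `#Ш(X)[2] = 2^{t_2(X) + 2·1}`).
* §4 (appended) CROSS-CHECK WITH THE TREE'S FIRST CERTIFICATE: `natCard_sha_torsionBy_two_X_of_examples` re-derives `= 4`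
  from g11's `ShaTwoTorsionExamples.natCard_sha_inf_torsionBy_two_X346` (sharp descent, no Cassels–Tate); the parity
  certificate of §2 (weak bracket + Cassels–Tate) and the descent certificate agree, as they must.
* §3 READING FOR T: `X` is a rank-`2` curve with a closed door (`t_2 = 0`) and a non-trivial SQUARE `2`-descent
  defect, exactly as T ∧ (door) predicts (`…OddDoor` §4); T by name then predicts `t_q(X) = 0` for every `q`
  (g11 `transfer_predicts_rankTwo`), i.e. square `q`-descent defects at every prime (`isSquare_natCard_sha_torsionBy_X_of_transfer`).

References: [SilvermanAEC2009] Thm. X.4.2(a), Prop. X.4.9, Example X.4.10, Thm. X.4.14; [Cassels1962ArithmeticIV]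
Thm. 1.1; [Dokchitser2013ParityNotes] §2; [SilvermanTate2015] §3.6.
-/

-- D-0017: single-problem summit, so `Summit.BirchSwinnertonDyer.BirchSwinnertonDyer.…` repeats a namespace BY DESIGN.
set_option linter.dupNamespace false
set_option autoImplicit false

noncomputable section

open scoped Classical
open scoped AddSubgroup
open Literature.NumberTheory.EllipticCurves Literature.NumberTheory.EllipticCurves.Curve346 WeierstrassCurve
open Literature.Algebra.Module (natCard_torsionBy_addSubgroup)
open WeierstrassCurve.Affine (SqUnits)

namespace Summit.BirchSwinnertonDyer.BirchSwinnertonDyer.Theorems.ShaPrimaryTransferOddDoor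

/-! ## §1 The bracket `4 ≤ #Ш(X/ℚ)[2] ≤ 8` (descent via `2`-isogeny on both sides) -/

/-- `#(Ш(X') ∩ im Ξ_{X'}) ≤ 2` and `≥ 1`, transported to the literal `X.twoIsogenyCodomain`.
[cite: SilvermanAEC2009, Thm. X.4.2(a) and Prop. X.4.9] -/
theorem natCard_sha_inf_range_twoIsogenyCodomain_X [hE : (⟨0, -346, 0, 1369, 0⟩ : WeierstrassCurve ℚ).IsElliptic] :
    1 ≤ Nat.card ↥((⟨0, -346, 0, 1369, 0⟩ : WeierstrassCurve ℚ).twoIsogenyCodomain.sha ⊓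
        AddMonoidHom.range (G := Additive (SqUnits ℚ))
          (⟨0, -346, 0, 1369, 0⟩ : WeierstrassCurve ℚ).twoIsogenyCodomain.twoIsogenyTorsorHom) ∧
      Nat.card ↥((⟨0, -346, 0, 1369, 0⟩ : WeierstrassCurve ℚ).twoIsogenyCodomain.sha ⊓
        AddMonoidHom.range (G := Additive (SqUnits ℚ))
          (⟨0, -346, 0, 1369, 0⟩ : WeierstrassCurve ℚ).twoIsogenyCodomain.twoIsogenyTorsorHom) ≤ 2 := by
  haveI := isElliptic_X'
  rw [natCard_sha_inf_range_twoIsogenyTorsorHom_congr twoIsogenyCodomain_X]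
  exact natCard_sha_inf_range_X'_le_two

/-- **The bracket `4 ≤ #Ш(X/ℚ)[2] ≤ 8`**: `#Ш(X)[φ] = 4 ≤ #Ш(X)[2] ≤ #Ш(X)[φ] · #Ш(X')[φ̂] ≤ 4 · 2`.
[cite: SilvermanAEC2009, Thm. X.4.2(a) and Prop. X.4.9] [cite: SilvermanTate2015, §3.6] -/
theorem natCard_sha_torsionBy_two_X_mem :
    4 ≤ Nat.card ((⟨0, -346, 0, 1369, 0⟩ : WeierstrassCurve ℚ).sha[(2 : ℤ)]) ∧
      Nat.card ((⟨0, -346, 0, 1369, 0⟩ : WeierstrassCurve ℚ).sha[(2 : ℤ)]) ≤ 8 := by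
  haveI := isElliptic_X
  have h4 := natCard_sha_inf_range_eq (hE := isElliptic_X)
  obtain ⟨h1', h2'⟩ := natCard_sha_inf_range_twoIsogenyCodomain_X
  haveI : Finite ↥((⟨0, -346, 0, 1369, 0⟩ : WeierstrassCurve ℚ).sha ⊓
      AddMonoidHom.range (G := Additive (SqUnits ℚ)) (⟨0, -346, 0, 1369, 0⟩ : WeierstrassCurve ℚ).twoIsogenyTorsorHom) :=
    Nat.finite_of_card_ne_zero (by rw [h4]; norm_num)
  haveI : Finite ↥((⟨0, -346, 0, 1369, 0⟩ : WeierstrassCurve ℚ).twoIsogenyCodomain.sha ⊓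
      AddMonoidHom.range (G := Additive (SqUnits ℚ))
        (⟨0, -346, 0, 1369, 0⟩ : WeierstrassCurve ℚ).twoIsogenyCodomain.twoIsogenyTorsorHom) :=
    Nat.finite_of_card_ne_zero (by omega)
  have hup := natCard_sha_torsionBy_two_le_mul (⟨0, -346, 0, 1369, 0⟩ : WeierstrassCurve ℚ)
  have hlow := natCard_sha_inf_range_le_natCard_sha_torsionBy_two (⟨0, -346, 0, 1369, 0⟩ : WeierstrassCurve ℚ)
  rw [h4] at hup hlow
  constructor
  · exact hlow
  · nlinarith

/-! ## §2 Cassels–Tate parity decides: `#Ш(X/ℚ)[2] = 4`, `Ш(X)[2] = Ш(X)[φ] ≅ (ℤ/2ℤ)²` -/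

/-- **`#Ш(X/ℚ)[2] = 4` exactly** for the rank-`2` curve `X = [0, −346, 0, 1369, 0]`: `t_2(X) = 0` (isogeny door)
and Cassels–Tate give `#Ш(X)[2] = 4^m` (`exists_natCard_sha_torsionBy_eq_pow`), and the bracket `4 ≤ · ≤ 8` forces
`m = 1`. (The value was already in the tree by sharp descent — `ShaTwoTorsionExamples.natCard_sha_inf_torsionBy_two_X346`,
seat g11; this is an independent parity-route proof that leaves the class `37` undecided.) [cite: Cassels1962ArithmeticIV, Thm. 1.1]
[cite: SilvermanAEC2009, Thm. X.4.14 and Prop. X.4.9] -/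
theorem natCard_sha_torsionBy_two_X : Nat.card ((⟨0, -346, 0, 1369, 0⟩ : WeierstrassCurve ℚ).sha[(2 : ℤ)]) = 4 := by
  haveI := isElliptic_X
  haveI : Fact (Nat.Prime 2) := ⟨Nat.prime_two⟩
  obtain ⟨hlow, hup⟩ := natCard_sha_torsionBy_two_X_mem
  obtain ⟨m, hm⟩ := exists_natCard_sha_torsionBy_eq_pow (⟨0, -346, 0, 1369, 0⟩ : WeierstrassCurve ℚ) 2
  rw [shaCorank_X_two, zero_add] at hm
  have hm' : Nat.card ((⟨0, -346, 0, 1369, 0⟩ : WeierstrassCurve ℚ).sha[((2 : ℕ) : ℤ)]) =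
      Nat.card ((⟨0, -346, 0, 1369, 0⟩ : WeierstrassCurve ℚ).sha[(2 : ℤ)]) := rfl
  rw [hm'] at hm
  rw [hm] at hlow hup ⊢
  have h1 : 1 ≤ m := by
    rcases Nat.eq_zero_or_pos m with rfl | h
    · norm_num at hlow
    · exact h
  have h2 : m ≤ 1 := by
    by_contra h
    have h16 : 2 ^ 4 ≤ 2 ^ (2 * m) := Nat.pow_le_pow_right (by norm_num) (by omega)
    norm_num at h16
    omega
  obtain rfl : m = 1 := le_antisymm h2 h1
  norm_num

/-- `#Ш(X/ℚ)[2] = 2^{t_2(X) + 2·1}`: the row of `…OddDoor` §1 with `m = 1` — the defect is ALL finite square part.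
[cite: Dokchitser2013ParityNotes, §2] -/
theorem natCard_sha_torsionBy_two_X_eq_pow :
    Nat.card ((⟨0, -346, 0, 1369, 0⟩ : WeierstrassCurve ℚ).sha[(2 : ℤ)]) =
      2 ^ ((⟨0, -346, 0, 1369, 0⟩ : WeierstrassCurve ℚ).shaCorank 2 + 2 * 1) := by
  rw [natCard_sha_torsionBy_two_X, shaCorank_X_two]
  norm_num

/-- **`Ш(X/ℚ)[2] = Ш(X/ℚ)[φ]`** as subgroups of `H¹(ℚ, X)`: `Ш(X) ∩ im Ξ_X ≤ Ш(X) ∩ H¹[2]` and both have `4` elements,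
so every `2`-torsion class of `Ш(X/ℚ)` dies in `Ш(X'/ℚ)` under `φ`. [cite: SilvermanAEC2009, Thm. X.4.2(a)] -/
theorem sha_inf_torsionBy_two_X_eq [hE : (⟨0, -346, 0, 1369, 0⟩ : WeierstrassCurve ℚ).IsElliptic] :
    (⟨0, -346, 0, 1369, 0⟩ : WeierstrassCurve ℚ).sha ⊓ AddSubgroup.torsionBy (⟨0, -346, 0, 1369, 0⟩ : WeierstrassCurve ℚ).galH1 2 =
      (⟨0, -346, 0, 1369, 0⟩ : WeierstrassCurve ℚ).sha ⊓
        AddMonoidHom.range (G := Additive (SqUnits ℚ)) (⟨0, -346, 0, 1369, 0⟩ : WeierstrassCurve ℚ).twoIsogenyTorsorHom := by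
  have h4 := natCard_sha_inf_range_eq (hE := hE)
  have h4' : Nat.card ↥((⟨0, -346, 0, 1369, 0⟩ : WeierstrassCurve ℚ).sha ⊓
      AddSubgroup.torsionBy (⟨0, -346, 0, 1369, 0⟩ : WeierstrassCurve ℚ).galH1 2) = 4 := by
    rw [← natCard_torsionBy_addSubgroup, natCard_sha_torsionBy_two_X]
  haveI : Finite ↥((⟨0, -346, 0, 1369, 0⟩ : WeierstrassCurve ℚ).sha ⊓
      AddSubgroup.torsionBy (⟨0, -346, 0, 1369, 0⟩ : WeierstrassCurve ℚ).galH1 2) :=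
    Nat.finite_of_card_ne_zero (by rw [h4']; norm_num)
  exact (AddSubgroup.eq_of_le_of_card_ge (sha_inf_range_twoIsogenyTorsorHom_le _) (by rw [h4, h4'])).symm

/-- **`Ш(X/ℚ)[2] ≅ (ℤ/2ℤ)²`**: an elementary abelian `2`-group of order `4`. [cite: SilvermanAEC2009, Thm. X.4.14] -/
theorem nonempty_sha_torsionBy_two_X_equiv :
    Nonempty (((⟨0, -346, 0, 1369, 0⟩ : WeierstrassCurve ℚ).sha[((2 : ℕ) : ℤ)]) ≃+ (Fin 2 → ZMod 2)) := by
  letI : Module (ZMod 2) (((⟨0, -346, 0, 1369, 0⟩ : WeierstrassCurve ℚ).sha)[((2 : ℕ) : ℤ)]) :=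
    AddSubgroup.torsionBy.zmodModule
  haveI : Fact (Nat.Prime 2) := ⟨Nat.prime_two⟩
  have h4 : Nat.card (((⟨0, -346, 0, 1369, 0⟩ : WeierstrassCurve ℚ).sha)[((2 : ℕ) : ℤ)]) = 4 :=
    natCard_sha_torsionBy_two_X
  haveI : Finite (((⟨0, -346, 0, 1369, 0⟩ : WeierstrassCurve ℚ).sha)[((2 : ℕ) : ℤ)]) :=
    Nat.finite_of_card_ne_zero (by rw [h4]; norm_num)
  haveI : Module.Finite (ZMod 2) (((⟨0, -346, 0, 1369, 0⟩ : WeierstrassCurve ℚ).sha)[((2 : ℕ) : ℤ)]) :=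
    Module.Finite.of_finite
  have hdim : Module.finrank (ZMod 2) (((⟨0, -346, 0, 1369, 0⟩ : WeierstrassCurve ℚ).sha)[((2 : ℕ) : ℤ)]) = 2 := by
    have h := pow_finrank_eq_natCard (p := 2) (((⟨0, -346, 0, 1369, 0⟩ : WeierstrassCurve ℚ).sha)[((2 : ℕ) : ℤ)])
    rw [h4, show (4 : ℕ) = 2 ^ 2 by norm_num] at h
    exact Nat.pow_right_injective le_rfl h
  have hdim' : Module.finrank (ZMod 2) (((⟨0, -346, 0, 1369, 0⟩ : WeierstrassCurve ℚ).sha)[((2 : ℕ) : ℤ)]) =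
      Module.finrank (ZMod 2) (Fin 2 → ZMod 2) := by
    rw [hdim, Module.finrank_fin_fun]
  exact ⟨(LinearEquiv.ofFinrankEq _ _ hdim').toAddEquiv⟩

/-! ## §3 Reading for T -/

open Summit.BirchSwinnertonDyer.BirchSwinnertonDyer.Theses.ShaPrimaryTransfer (FiniteShaComponentTransfer)

/-- **The isogeny-door row, complete**: `rank X(ℚ) = 2`, `t_2(X) = 0`, `#Ш(X/ℚ)[2] = 4` — a rank-`2` curve with a
closed door and a non-trivial SQUARE `2`-descent defect, the situation `…OddDoor` §4 says T ∧ (door) permits.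
[cite: SilvermanAEC2009, Thm. X.4.14] [cite: Greenberg1999LNM, §1 pp. 54–57] -/
theorem isogenyDoor_row_X :
    (⟨0, -346, 0, 1369, 0⟩ : WeierstrassCurve ℚ).mordellWeilRank = 2 ∧
      (⟨0, -346, 0, 1369, 0⟩ : WeierstrassCurve ℚ).shaCorank 2 = 0 ∧
      Nat.card ((⟨0, -346, 0, 1369, 0⟩ : WeierstrassCurve ℚ).sha[(2 : ℤ)]) = 4 :=
  ⟨mordellWeilRank_X, shaCorank_X_two, natCard_sha_torsionBy_two_X⟩

/-- **Granting T, every descent defect of `X` is a square** (the door at `2` is closed on `X`); at `2` this is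
now a theorem with the value `4`. [cite: SilvermanAEC2009, Thm. X.4.14] -/
theorem isSquare_natCard_sha_torsionBy_X_of_transfer (hT : FiniteShaComponentTransfer) (q : ℕ) [Fact q.Prime] :
    IsSquare (Nat.card ((⟨0, -346, 0, 1369, 0⟩ : WeierstrassCurve ℚ).sha[(q : ℤ)])) := by
  haveI := isElliptic_X
  haveI : Fact (Nat.Prime 2) := ⟨Nat.prime_two⟩
  exact isSquare_natCard_sha_torsionBy_of_transfer 2 _ q hT shaCorank_X_two

/-- Unconditionally at `q = 2`: `#Ш(X/ℚ)[2] = 4 = 2²` is a square. [cite: SilvermanAEC2009, Thm. X.4.14] -/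
theorem isSquare_natCard_sha_torsionBy_two_X :
    IsSquare (Nat.card ((⟨0, -346, 0, 1369, 0⟩ : WeierstrassCurve ℚ).sha[(2 : ℤ)])) :=
  ⟨2, by rw [natCard_sha_torsionBy_two_X]⟩

/-! ## §4 (appended) Cross-check with the tree's first certificate (g11, sharp descent) -/

/-- **The two certificates agree**: the tree's earlier, Cassels–Tate-free value `#(Ш(X₃₄₆) ∩ H¹[2]) = 4`
(`ShaTwoTorsionExamples.natCard_sha_inf_torsionBy_two_X346`, seat g11: `Ш(X')[φ̂] = 0` because the class `37` dies over `ℚ₅`,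
then `Ш[2] = Ш[φ]` by `TwoIsogenyShaTwoTorsionEqPhi`) gives `#Ш(X/ℚ)[2] = 4` in `Nat.card (Ш[2])` currency — the same value
§2 obtained from the WEAK bracket (class `37` undecided) and Cassels–Tate parity. [cite: SilvermanAEC2009, Prop. X.6.5(b) (the method)] -/
theorem natCard_sha_torsionBy_two_X_of_examples :
    Nat.card ((⟨0, -346, 0, 1369, 0⟩ : WeierstrassCurve ℚ).sha[(2 : ℤ)]) = 4 := by
  haveI := isElliptic_X
  rw [natCard_torsionBy_addSubgroup]
  exact ShaTwoTorsionExamples.natCard_sha_inf_torsionBy_two_X346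

/-- The parity certificate and the descent certificate give the same number (definitionally the same statement;
recorded for the census). [cite: SilvermanAEC2009, Prop. X.6.5(b)] -/
theorem natCard_sha_torsionBy_two_X_certificates_agree :
    natCard_sha_torsionBy_two_X = natCard_sha_torsionBy_two_X_of_examples := rfl

end Summit.BirchSwinnertonDyer.BirchSwinnertonDyer.Theorems.ShaPrimaryTransferOddDoor

end
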